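import Summits.AtomisticToContinuum.Crystallization.Theses.ExcessDecayLiouville
import Summits.AtomisticToContinuum.Crystallization.Theorems.CrystalLocalRigidityAssembly

/-!
# Route `ExcessDecayLiouville`, item stmt-AtomisticToContinuum-9338 `Assembly`

The assembly of route `AtomisticToContinuum/Crystallization/ExcessDecayLiouville`:

`GrainsGlue → LimitGlue → PhononStability → HcpLiouville → CoarseGrains → CrysPeriodicMinAttained →
CrysEnergyLimit → Crystallization`.

Pure logic: `GrainsGlue` applied to the three cruxes (`PhononStability`, `HcpLiouville`,
`CoarseGrains`) gives `FineGrains`; `LimitGlue` turns that into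
`IsCrystallizing lennardJones 3`; together with `CrysPeriodicMinAttained` (the periodic infimum of
the Lennard-Jones energy per particle is attained) and `CrysEnergyLimit` (`E(N)/N → ⨅_Q e(Q)`) the
conjunct `Crystallization = HasPeriodicGroundStateEnergy ∧ IsCrystallizing` follows from the
in-tree assembly lemma `Literature.StatMech.crystallization_of_isLeast_tendsto_isCrystallizing`
(a least element of the range is the `⨅`, `IsLeast.csInf_eq`).
-/

namespace Summit.AtomisticToContinuum.Crystallization.Theorems

/-- **Item stmt-AtomisticToContinuum-9338** (`Assembly`, route `ExcessDecayLiouville`):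
`GrainsGlue → LimitGlue → PhononStability → HcpLiouville → CoarseGrains → CrysPeriodicMinAttained →
CrysEnergyLimit → Crystallization`.  The glue and the three cruxes give `FineGrains`, `LimitGlue`
gives positional crystallization, and the energetic half is
`Literature.StatMech.crystallization_of_isLeast_tendsto_isCrystallizing` (stmt-0622). -/
theorem excessDecayLiouville_assembly_proof :
    Summit.AtomisticToContinuum.Crystallization.Theses.ExcessDecayLiouville.Assembly := by
  unfold Summit.AtomisticToContinuum.Crystallization.Theses.ExcessDecayLiouville.Assembly
  intro hGrainsGlue hLimitGlue hPhonon hLiouville hCoarse hMin hLim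
  exact Literature.StatMech.crystallization_of_isLeast_tendsto_isCrystallizing
    ⟨hMin, hLim, hLimitGlue (hGrainsGlue hPhonon hLiouville hCoarse)⟩

end Summit.AtomisticToContinuum.Crystallization.Theorems
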